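import Literature.NumberTheory.LFunctions.HardyZSqTwistedMoment
import Literature.NumberTheory.LFunctions.RiemannSiegelPhase
import Mathlib.MeasureTheory.Integral.Bochner.ContinuousLinearMap
import HarnessLib

/-!
# `|ζ(½+it)|² = 2|S_t|² + 2 Re(Θ² S_t²) + O(t^{-1/4}|S_t| + t^{-1/2})` with the activated main sum
# `S_t = Σ_{n ≤ ⌊√(t/2π)⌋} n^{-1/2-it}` — the first step of the BCH mean square

Topic `Literature/NumberTheory/LFunctions`. Everything in this file is PROVED (no named facts; the only
definition is the transparent abbreviation `BCH.actMainSum`).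

The Balasubramanian–Conrey–Heath-Brown mean square (named fact
`Literature.Barriers.RiemannHypothesis.BalasubramanianConreyHeathBrown1985_meanSquare`) is approached in
the tree along Titchmarsh §§7.4, 9.20–9.23 / Levinson 1974 with *activated* lengths: instead of
freezing the length `P` of the approximate functional equation sum on a block (Titchmarsh §9.20,
`Z = z₁ + z̄₁ + e` with the tree's `TwistedMoment.hardyZErr P`), one takes `P = ⌊√(t/2π)⌋` at every
`t`, so that the error is the pure approximate-functional-equation error `O(t^{-1/4})`:

* `BCH.actMainSum t = Σ_{n ≤ ⌊√(t/2π)⌋} n^{-1/2-it}` (`= TwistedMoment.mainSum ⌊√(t/2π)⌋ t`);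
* `BCH.hardyZ_eq_twoRe_add_err` — `Z(t) = Θ S_t + conj(Θ S_t) + e_t` with `Θ = thetaMainPhase`,
  `e_t = hardyZErr ⌊√(t/2π)⌋ t`;
* `BCH.norm_actErr_le` — `‖e_t‖ ≤ C₁ t^{-1/4}` for `t ≥ t₁` (the tree's `TwistedMoment.norm_hardyZErr_le`
  with an empty tail sum);
* `BCH.norm_sq_zeta_half_eq_hardyZ_sq` — `|ζ(½+it)|² = Z(t)²`;
* `BCH.zetaSq_mul_eq_decomp` — pointwise, for any complex `A`:
  `|ζ(½+it)|²|A|² = 2|S_t A|² + Θ²S_t²|A|² + conj(Θ²S_t²|A|²) + R_t(A)` with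
  `‖R_t(A)‖ ≤ (4η|S_t|² + (1 + 1/η)‖e_t‖²)|A|²` for every `η > 0` (`BCH.norm_decompRem_le`);
* `BCH.norm_integral_zetaSq_mul_sub_le` — **integrated form**: for a continuous `A : ℝ → ℂ`,
  `t₁ ≤ T ≤ T'`, and the two structured pieces interval-integrable (they are finite sums of
  activated terms; the callers expand them),
  `‖∫_T^{T'} |ζ(½+it)|²|A(t)|² − 2∫_T^{T'}|S_t A|² − ∫_T^{T'} Θ²S_t²|A|² − conj ∫_T^{T'} Θ²S_t²|A|²‖`
  `  ≤ 4η ∫_T^{T'} |S_t A|² + (1 + 1/η) C₁² T^{-1/2} ∫_T^{T'} |A|²`.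
  With `η = T^{-1/4}` both remainders are `O(B² T^{3/4} log⁴ T)` for the mean squares at hand.

## References

* [Titchmarsh1986] E. C. Titchmarsh, *The Theory of the Riemann Zeta-Function*, 2nd ed. (1986),
  §4.17 (approximate functional equation), §7.4, §9.20 (`Z = z₁ + z̄₁ + e`).
* [Levinson1974] N. Levinson, Adv. Math. 13 (1974), 383–436, §2 (2.10)–(2.18) (the same decomposition
  with `t`-dependent length).
-/

noncomputable section

open Finset Real MeasureTheory Complex Set intervalIntegral
open scoped ComplexConjugate

namespace Literature.NumberTheory.LFunctions.BCH

open Literature.NumberTheory.LFunctions.TwistedMoment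

/-! ### The activated main sum and the pointwise decomposition of `Z` -/

/-- The **activated main sum** `S_t = Σ_{n ≤ ⌊√(t/2π)⌋} n^{-1/2-it}` of the approximate functional
equation on the critical line (the tree's `TwistedMoment.mainSum` at the `t`-dependent length).
[cite: Titchmarsh1986, §4.17] -/
def actMainSum (t : ℝ) : ℂ := mainSum ⌊Real.sqrt (t / (2 * π))⌋₊ t

/-- Unfolding `actMainSum`. [folklore] -/
theorem actMainSum_def (t : ℝ) : actMainSum t = mainSum ⌊Real.sqrt (t / (2 * π))⌋₊ t := rfl

/-- `Z(t) = Θ(t) S_t + conj(Θ(t) S_t) + e_t` with `e_t = hardyZErr ⌊√(t/2π)⌋ t`. [cite: Titchmarsh1986, §9.20] -/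
theorem hardyZ_eq_twoRe_add_err (t : ℝ) :
    (hardyZ t : ℂ) = thetaMainPhase t * actMainSum t + conj (thetaMainPhase t * actMainSum t) +
      hardyZErr ⌊Real.sqrt (t / (2 * π))⌋₊ t := by
  rw [hardyZErr_def, actMainSum]
  ring

/-- **The activated error is the pure approximate-functional-equation error**: there are `C₁ > 0`,
`t₁ ≥ 2` with `‖hardyZErr ⌊√(t/2π)⌋ t‖ ≤ C₁ t^{-1/4}` for `t ≥ t₁`. [cite: Titchmarsh1986, §4.17] -/
theorem norm_actErr_le : ∃ C₁ t₁ : ℝ, 0 < C₁ ∧ 2 ≤ t₁ ∧ ∀ t : ℝ, t₁ ≤ t →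
    ‖hardyZErr ⌊Real.sqrt (t / (2 * π))⌋₊ t‖ ≤ C₁ * t ^ (-(1 / 4 : ℝ)) := by
  obtain ⟨C₁, t₁, hC₁, ht₁, h⟩ := norm_hardyZErr_le
  refine ⟨C₁, t₁, hC₁, ht₁, fun t ht => ?_⟩
  have ht0 : 0 ≤ t := by linarith
  have hP : 2 * π * ((⌊Real.sqrt (t / (2 * π))⌋₊ : ℕ) : ℝ) ^ 2 ≤ t := by
    have h1 : ((⌊Real.sqrt (t / (2 * π))⌋₊ : ℕ) : ℝ) ≤ Real.sqrt (t / (2 * π)) :=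
      Nat.floor_le (Real.sqrt_nonneg _)
    have h2 : ((⌊Real.sqrt (t / (2 * π))⌋₊ : ℕ) : ℝ) ^ 2 ≤ t / (2 * π) := by
      calc ((⌊Real.sqrt (t / (2 * π))⌋₊ : ℕ) : ℝ) ^ 2 ≤ Real.sqrt (t / (2 * π)) ^ 2 :=
            pow_le_pow_left₀ (Nat.cast_nonneg _) h1 2
        _ = t / (2 * π) := Real.sq_sqrt (by positivity)
    rw [le_div_iff₀ (by positivity)] at h2
    linarith
  have := h ⌊Real.sqrt (t / (2 * π))⌋₊ t ht hP
  rwa [sub_self, norm_zero, mul_zero, zero_add] at this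

/-- `|ζ(½+it)|² = Z(t)²`. [cite: Titchmarsh1986, §4.17] -/
theorem norm_sq_zeta_half_eq_hardyZ_sq (t : ℝ) :
    ‖riemannZeta (1 / 2 + t * I)‖ ^ 2 = hardyZ t ^ 2 := by
  rw [← abs_hardyZ_eq_norm_riemannZeta_holds t, sq_abs]

/-! ### The pointwise decomposition of `|ζ|²|A|²` -/

/-- The remainder `R_t(A) = (2(ΘS_t + conj(ΘS_t)) e_t + e_t²) |A|²` of the decomposition.
[folklore] -/
def decompRem (A : ℂ) (t : ℝ) : ℂ :=
  (2 * (thetaMainPhase t * actMainSum t + conj (thetaMainPhase t * actMainSum t)) *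
      hardyZErr ⌊Real.sqrt (t / (2 * π))⌋₊ t +
    hardyZErr ⌊Real.sqrt (t / (2 * π))⌋₊ t ^ 2) * ((‖A‖ ^ 2 : ℝ) : ℂ)

/-- Unfolding `decompRem`. [folklore] -/
theorem decompRem_def (A : ℂ) (t : ℝ) : decompRem A t =
    (2 * (thetaMainPhase t * actMainSum t + conj (thetaMainPhase t * actMainSum t)) *
        hardyZErr ⌊Real.sqrt (t / (2 * π))⌋₊ t +
      hardyZErr ⌊Real.sqrt (t / (2 * π))⌋₊ t ^ 2) * ((‖A‖ ^ 2 : ℝ) : ℂ) := rfl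

/-- **Pointwise decomposition.** For every complex `A` and real `t`:
`|ζ(½+it)|²|A|² = 2|S_t A|² + Θ²S_t²|A|² + conj(Θ²S_t²|A|²) + R_t(A)`
(`(w + w̄)² = Θ²S² + conj(Θ²S²) + 2SS̄` for `w = ΘS`, `|Θ| = 1`; the tree's
`TwistedMoment.sq_add_conj_eq`). [cite: Titchmarsh1986, §7.4] -/
theorem zetaSq_mul_eq_decomp (A : ℂ) (t : ℝ) :
    (((‖riemannZeta (1 / 2 + t * I)‖ ^ 2 * ‖A‖ ^ 2 : ℝ)) : ℂ) =
      2 * (((‖actMainSum t * A‖ ^ 2 : ℝ)) : ℂ) +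
        thetaMainPhase t ^ 2 * actMainSum t ^ 2 * ((‖A‖ ^ 2 : ℝ) : ℂ) +
        conj (thetaMainPhase t ^ 2 * actMainSum t ^ 2 * ((‖A‖ ^ 2 : ℝ) : ℂ)) +
        decompRem A t := by
  have hΘ : thetaMainPhase t * conj (thetaMainPhase t) = 1 := by
    rw [Complex.mul_conj, Complex.normSq_eq_norm_sq, norm_thetaMainPhase t]
    norm_num
  have hS : actMainSum t * conj (actMainSum t) = ((‖actMainSum t‖ : ℝ) : ℂ) ^ 2 := by
    rw [Complex.mul_conj, Complex.normSq_eq_norm_sq, Complex.ofReal_pow]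
  rw [norm_sq_zeta_half_eq_hardyZ_sq, decompRem_def, norm_mul]
  push_cast
  rw [hardyZ_eq_twoRe_add_err t]
  simp only [map_mul, map_pow, Complex.conj_ofReal]
  linear_combination (2 * ((‖A‖ : ℝ) : ℂ) ^ 2 * (actMainSum t * conj (actMainSum t))) * hΘ +
    (2 * ((‖A‖ : ℝ) : ℂ) ^ 2) * hS

/-- **Size of the remainder**: `‖R_t(A)‖ ≤ (4η|S_t|² + (1 + 1/η)‖e_t‖²)|A|²` for `η > 0`
(`‖2ab + b²‖ ≤ η‖a‖² + (1+1/η)‖b‖²`, `‖ΘS + conj(ΘS)‖ ≤ 2|S|`). [folklore] -/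
theorem norm_decompRem_le (A : ℂ) (t : ℝ) {η : ℝ} (hη : 0 < η) :
    ‖decompRem A t‖ ≤ (4 * η * ‖actMainSum t‖ ^ 2 +
      (1 + 1 / η) * ‖hardyZErr ⌊Real.sqrt (t / (2 * π))⌋₊ t‖ ^ 2) * ‖A‖ ^ 2 := by
  set w : ℂ := thetaMainPhase t * actMainSum t with hw
  set e : ℂ := hardyZErr ⌊Real.sqrt (t / (2 * π))⌋₊ t with he
  have h1 := norm_two_mul_add_sq_le (a := w + conj w) (b := e) hη
  have hwn : ‖w‖ = ‖actMainSum t‖ := by rw [hw, norm_mul, norm_thetaMainPhase, one_mul]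
  have h2 : ‖w + conj w‖ ≤ 2 * ‖actMainSum t‖ := by
    calc ‖w + conj w‖ ≤ ‖w‖ + ‖conj w‖ := norm_add_le _ _
      _ = 2 * ‖actMainSum t‖ := by rw [Complex.norm_conj, hwn]; ring
  have h3 : ‖w + conj w‖ ^ 2 ≤ 4 * ‖actMainSum t‖ ^ 2 := by
    nlinarith [norm_nonneg (w + conj w), norm_nonneg (actMainSum t)]
  rw [decompRem_def, ← hw, ← he, norm_mul, Complex.norm_real, Real.norm_eq_abs,
    abs_of_nonneg (sq_nonneg _)]
  refine mul_le_mul_of_nonneg_right ?_ (sq_nonneg _)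
  calc ‖2 * (w + conj w) * e + e ^ 2‖ ≤ η * ‖w + conj w‖ ^ 2 + (1 + 1 / η) * ‖e‖ ^ 2 := h1
    _ ≤ η * (4 * ‖actMainSum t‖ ^ 2) + (1 + 1 / η) * ‖e‖ ^ 2 := by
        have : 0 ≤ 1 + 1 / η := by positivity
        nlinarith [mul_le_mul_of_nonneg_left h3 hη.le]
    _ = 4 * η * ‖actMainSum t‖ ^ 2 + (1 + 1 / η) * ‖e‖ ^ 2 := by ring

/-! ### Continuity of `|ζ(½+it)|²` -/

/-- `t ↦ |ζ(½+it)|²` is continuous. [folklore] -/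
theorem continuous_norm_sq_zeta_half :
    Continuous fun t : ℝ => ‖riemannZeta (1 / 2 + t * I)‖ ^ 2 := by
  have : (fun t : ℝ => ‖riemannZeta (1 / 2 + t * I)‖ ^ 2) = fun t => hardyZ t ^ 2 :=
    funext norm_sq_zeta_half_eq_hardyZ_sq
  rw [this]
  exact continuous_hardyZ.pow 2

/-! ### The integrated decomposition -/

/-- **The integrated decomposition of `∫|ζ(½+it)|²|A(t)|²`.** Let `A : ℝ → ℂ` be continuous,
`0 < t₁ ≤ T ≤ T'` (`t₁`, `C₁` as in `BCH.norm_actErr_le`), `η > 0`, and suppose the two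
structured pieces `t ↦ |S_t A(t)|²` and `t ↦ Θ(t)²S_t²|A(t)|²` are interval-integrable on `[T,T']`
(they are finite sums of activated terms). Then
`‖∫_T^{T'}|ζ(½+it)|²|A|² − 2∫_T^{T'}|S_t A|² − ∫_T^{T'}Θ²S_t²|A|² − conj ∫_T^{T'}Θ²S_t²|A|²‖`
`  ≤ 4η ∫_T^{T'}|S_t A|² + (1 + 1/η) C₁² T^{-1/2} ∫_T^{T'}|A|²`. [cite: Titchmarsh1986, §7.4] -/
theorem norm_integral_zetaSq_mul_sub_le {C₁ t₁ : ℝ}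
    (herr : ∀ t : ℝ, t₁ ≤ t → ‖hardyZErr ⌊Real.sqrt (t / (2 * π))⌋₊ t‖ ≤ C₁ * t ^ (-(1 / 4 : ℝ)))
    {A : ℝ → ℂ} (hA : Continuous A) {T T' : ℝ} (ht₁ : 0 < t₁) (hT : t₁ ≤ T) (hTT' : T ≤ T')
    (hF₂ : IntervalIntegrable (fun t => (((‖actMainSum t * A t‖ ^ 2 : ℝ)) : ℂ)) volume T T')
    (hF₃ : IntervalIntegrable
      (fun t => thetaMainPhase t ^ 2 * actMainSum t ^ 2 * ((‖A t‖ ^ 2 : ℝ) : ℂ)) volume T T')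
    {η : ℝ} (hη : 0 < η) :
    ‖(∫ t in T..T', (((‖riemannZeta (1 / 2 + t * I)‖ ^ 2 * ‖A t‖ ^ 2 : ℝ)) : ℂ)) -
        2 * (∫ t in T..T', (((‖actMainSum t * A t‖ ^ 2 : ℝ)) : ℂ)) -
        (∫ t in T..T', thetaMainPhase t ^ 2 * actMainSum t ^ 2 * ((‖A t‖ ^ 2 : ℝ) : ℂ)) -
        conj (∫ t in T..T', thetaMainPhase t ^ 2 * actMainSum t ^ 2 * ((‖A t‖ ^ 2 : ℝ) : ℂ))‖ ≤
      4 * η * (∫ t in T..T', ‖actMainSum t * A t‖ ^ 2) +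
        (1 + 1 / η) * C₁ ^ 2 * T ^ (-(1 / 2 : ℝ)) * ∫ t in T..T', ‖A t‖ ^ 2 := by
  have hT0 : 0 < T := lt_of_lt_of_le ht₁ hT
  -- the full integrand and the conjugate piece are interval integrable
  have hF₁ : IntervalIntegrable
      (fun t => (((‖riemannZeta (1 / 2 + t * I)‖ ^ 2 * ‖A t‖ ^ 2 : ℝ)) : ℂ)) volume T T' :=
    (Complex.continuous_ofReal.comp (continuous_norm_sq_zeta_half.mul (hA.norm.pow 2))).intervalIntegrable _ _
  have hF₃c : IntervalIntegrable
      (fun t => conj (thetaMainPhase t ^ 2 * actMainSum t ^ 2 * ((‖A t‖ ^ 2 : ℝ) : ℂ))) volume T T' := by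
    have h := (⟨(Complex.conjCLE.toContinuousLinearMap).integrable_comp hF₃.1,
      (Complex.conjCLE.toContinuousLinearMap).integrable_comp hF₃.2⟩ :
      IntervalIntegrable (fun t => Complex.conjCLE.toContinuousLinearMap
        (thetaMainPhase t ^ 2 * actMainSum t ^ 2 * ((‖A t‖ ^ 2 : ℝ) : ℂ))) volume T T')
    refine IntervalIntegrable.congr_ae h (Filter.Eventually.of_forall fun t => ?_)
    simp
  -- the remainder is interval integrable, as a combination
  have hRfun : (fun t : ℝ => decompRem (A t) t) = fun t : ℝ =>
      (((‖riemannZeta (1 / 2 + t * I)‖ ^ 2 * ‖A t‖ ^ 2 : ℝ)) : ℂ) -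
        2 * (((‖actMainSum t * A t‖ ^ 2 : ℝ)) : ℂ) -
        thetaMainPhase t ^ 2 * actMainSum t ^ 2 * ((‖A t‖ ^ 2 : ℝ) : ℂ) -
        conj (thetaMainPhase t ^ 2 * actMainSum t ^ 2 * ((‖A t‖ ^ 2 : ℝ) : ℂ)) := by
    funext t
    have h := zetaSq_mul_eq_decomp (A t) t
    rw [h]; ring
  have hR : IntervalIntegrable (fun t => decompRem (A t) t) volume T T' := by
    rw [hRfun]
    exact ((hF₁.sub (hF₂.const_mul 2)).sub hF₃).sub hF₃c
  -- the integral of the remainder is the difference in question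
  have hint : (∫ t in T..T', decompRem (A t) t) =
      (∫ t in T..T', (((‖riemannZeta (1 / 2 + t * I)‖ ^ 2 * ‖A t‖ ^ 2 : ℝ)) : ℂ)) -
        2 * (∫ t in T..T', (((‖actMainSum t * A t‖ ^ 2 : ℝ)) : ℂ)) -
        (∫ t in T..T', thetaMainPhase t ^ 2 * actMainSum t ^ 2 * ((‖A t‖ ^ 2 : ℝ) : ℂ)) -
        conj (∫ t in T..T', thetaMainPhase t ^ 2 * actMainSum t ^ 2 * ((‖A t‖ ^ 2 : ℝ) : ℂ)) := by
    rw [hRfun, intervalIntegral.integral_sub ((hF₁.sub (hF₂.const_mul 2)).sub hF₃) hF₃c,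
      intervalIntegral.integral_sub (hF₁.sub (hF₂.const_mul 2)) hF₃,
      intervalIntegral.integral_sub hF₁ (hF₂.const_mul 2), intervalIntegral.integral_const_mul]
    congr 1
    -- `∫ conj f = conj ∫ f`
    rw [intervalIntegral.integral_of_le hTT', intervalIntegral.integral_of_le hTT', integral_conj]
  rw [← hint]
  -- pointwise bound on the remainder
  have hbound : ∀ t ∈ Set.Ioc T T', ‖decompRem (A t) t‖ ≤
      4 * η * ‖actMainSum t * A t‖ ^ 2 + (1 + 1 / η) * C₁ ^ 2 * T ^ (-(1 / 2 : ℝ)) * ‖A t‖ ^ 2 := by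
    intro t ht
    have htT : T < t := ht.1
    have ht0 : 0 < t := hT0.trans htT
    have h1 := norm_decompRem_le (A t) t hη
    have h2 := herr t (by linarith)
    have h3 : ‖hardyZErr ⌊Real.sqrt (t / (2 * π))⌋₊ t‖ ^ 2 ≤ C₁ ^ 2 * T ^ (-(1 / 2 : ℝ)) := by
      have h4 : ‖hardyZErr ⌊Real.sqrt (t / (2 * π))⌋₊ t‖ ^ 2 ≤ (C₁ * t ^ (-(1 / 4 : ℝ))) ^ 2 :=
        pow_le_pow_left₀ (norm_nonneg _) h2 2
      have h5 : (t ^ (-(1 / 4 : ℝ))) ^ 2 = t ^ (-(1 / 2 : ℝ)) := by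
        rw [← Real.rpow_natCast, ← Real.rpow_mul ht0.le]; norm_num
      have h6 : t ^ (-(1 / 2 : ℝ)) ≤ T ^ (-(1 / 2 : ℝ)) :=
        Real.rpow_le_rpow_of_nonpos hT0 htT.le (by norm_num)
      calc ‖hardyZErr ⌊Real.sqrt (t / (2 * π))⌋₊ t‖ ^ 2 ≤ C₁ ^ 2 * t ^ (-(1 / 2 : ℝ)) := by
            rw [mul_pow, h5] at h4; exact h4
        _ ≤ C₁ ^ 2 * T ^ (-(1 / 2 : ℝ)) := mul_le_mul_of_nonneg_left h6 (sq_nonneg _)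
    have hη' : 0 ≤ 1 + 1 / η := by positivity
    calc ‖decompRem (A t) t‖ ≤ (4 * η * ‖actMainSum t‖ ^ 2 +
          (1 + 1 / η) * ‖hardyZErr ⌊Real.sqrt (t / (2 * π))⌋₊ t‖ ^ 2) * ‖A t‖ ^ 2 := h1
      _ ≤ (4 * η * ‖actMainSum t‖ ^ 2 + (1 + 1 / η) * (C₁ ^ 2 * T ^ (-(1 / 2 : ℝ)))) * ‖A t‖ ^ 2 := by
          gcongr
      _ = 4 * η * ‖actMainSum t * A t‖ ^ 2 + (1 + 1 / η) * C₁ ^ 2 * T ^ (-(1 / 2 : ℝ)) * ‖A t‖ ^ 2 := by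
          rw [norm_mul, mul_pow]; ring
  -- integrate the bound
  have hG₁ : IntervalIntegrable (fun t => ‖actMainSum t * A t‖ ^ 2) volume T T' := by
    have h := (⟨Complex.reCLM.integrable_comp hF₂.1, Complex.reCLM.integrable_comp hF₂.2⟩ :
      IntervalIntegrable (fun t => Complex.reCLM (((‖actMainSum t * A t‖ ^ 2 : ℝ)) : ℂ)) volume T T')
    refine IntervalIntegrable.congr_ae h (Filter.Eventually.of_forall fun t => ?_)
    show Complex.reCLM (((‖actMainSum t * A t‖ ^ 2 : ℝ)) : ℂ) = ‖actMainSum t * A t‖ ^ 2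
    rw [Complex.reCLM_apply, Complex.ofReal_re]
  have hG₂ : IntervalIntegrable (fun t => ‖A t‖ ^ 2) volume T T' := (hA.norm.pow 2).intervalIntegrable _ _
  have hG : IntervalIntegrable (fun t => 4 * η * ‖actMainSum t * A t‖ ^ 2 +
      (1 + 1 / η) * C₁ ^ 2 * T ^ (-(1 / 2 : ℝ)) * ‖A t‖ ^ 2) volume T T' :=
    (hG₁.const_mul _).add (hG₂.const_mul _)
  calc ‖∫ t in T..T', decompRem (A t) t‖
      ≤ ∫ t in T..T', (4 * η * ‖actMainSum t * A t‖ ^ 2 +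
          (1 + 1 / η) * C₁ ^ 2 * T ^ (-(1 / 2 : ℝ)) * ‖A t‖ ^ 2) :=
        intervalIntegral.norm_integral_le_of_norm_le hTT'
          (Filter.Eventually.of_forall hbound) hG
    _ = 4 * η * (∫ t in T..T', ‖actMainSum t * A t‖ ^ 2) +
        (1 + 1 / η) * C₁ ^ 2 * T ^ (-(1 / 2 : ℝ)) * ∫ t in T..T', ‖A t‖ ^ 2 := by
        rw [intervalIntegral.integral_add (hG₁.const_mul _) (hG₂.const_mul _),
          intervalIntegral.integral_const_mul, intervalIntegral.integral_const_mul]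

end Literature.NumberTheory.LFunctions.BCH
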